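import Literature.Analysis.FluidPDE.NSVorticityBKMEnergy
import Literature.Analysis.FluidPDE.ConstantinODELemma
import HarnessLib

/-!
# Constantin's comparison theorem, III: time integration of the slice inequality, removal of
# the cut-off, and the a priori estimate `E ≤ K₀ν²`

Analysis/FluidPDE support file (theorems only; no definitions, no named facts) on the discharge
path of `Literature.Analysis.FluidPDE.constantin_small_viscosity` (`ConstantinSmallViscosity.lean`;
P. Constantin, *Note on loss of regularity for solutions of the 3-D incompressible Euler and
related equations*, Comm. Math. Phys. 104 (1986) 311–326, §1, Thm. 1.1, held text
`paper:doi-10-1007-bf01211598` pp. 4–7).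

Setting: an unforced classical Navier–Stokes solution `(u, p)` (viscosity `ν`) and an unforced
classical Euler solution `(U, P)` on the closed slab `[0, S] × ℝ³`, both with all `L²` Sobolev
norms bounded on `[0, S]` (`HasBoundedSobolevNormsOn`), and `u 0 = U 0`. The **squared Sobolev
energy of the difference** at level `k` is

  `E(t) = ∑_{n ≤ k} ∫ |∇ⁿ(u(t) − U(t))|²`  (`|∇ⁿ·|² = levelSq n`, the coordinate tensors of
  `CoordDerivatives`),

Constantin's `|w(t)|²ₘ` ((1.5), (1.10)). This file turns a **slice inequality** — a bound, at
every interior time and for every cut-off radius `R ≥ 1`, of the localised pairings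
`2 ∑_{n ≤ k} ∑_{|α| = n} ∑ᵢ ∫ χ_R ∂ₜ(∂^α wᵢ) ∂^α wᵢ` by `Φ(E(t)) + K/R`,
`Φ(e) = A e + B e √e + ν K' √e` (the shape produced by the energy method, Constantin's (1.10);
proved for these solutions in the companion slice files) — into

* the **integral inequality** `E(t) ≤ ∫₀ᵗ Φ(E(s)) ds` on `[0, S]`
  (`energy_le_integral_of_slice`): the fundamental theorem of calculus on time lines and Fubini
  for each localised component energy `∫ χ_R (∂^α wᵢ)²` (tree `EnergyToolkit`), `w(0) = 0`, and
  `R → ∞` by dominated convergence (`tendsto_integral_cutoff_pow_mul_atTop`) — no bound on any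
  time derivative and no hypothesis on the pressures is needed for this step;
* the properties of `E` needed by the ODE lemma (`ConstantinODELemma`): boundedness on the slab,
  `E(0) = 0`, measurability of the clamped energy (a parametric integral of a jointly continuous
  integrand) and closedness from the left (`E` is a supremum of the time-continuous localised
  energies), `energy_props`;
* the **a priori estimate** (`energy_le_of_slice`, Constantin's (1.18) squared):
  `E(t) ≤ K² T² e^{AT + 1/2} ν²` on `[0, S]`, `S ≤ T`, whenever `ν B T (K²T²e^{AT+1/2})^{1/2} ≤ 1/4`
  (`constantin_energy_bootstrap`).

## Mathlib / tree search

Tree (used): `IsSmoothSpaceTimeOn.ipderiv_slice/timeDerivWithin`,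
`integral_Ioo_integral_mul_timeDerivWithin_mul`, `continuousOn_integral_mul_of_continuousOn`
(`EnergyToolkit`, `ClassicalSolutionCalculus`), `levelSq`/`dnormSq` (`CoordDerivatives`),
`integrable_levelSq_of_lintegral_lt_top`, `integrableOn_Ioo_of_continuousOn`,
`Icc_subset_closure_interior` (`NSEnstrophyPersistence`), `tendsto_integral_cutoff_pow_mul_atTop`,
`levelSq_bounds_of_hasBoundedSobolevNormsOn` (`NSVorticityBKMTools`), `continuous_clamp_comp`,
`clamp_eq` (`NormalisedPressureDischarge`), `constantin_energy_bootstrap` (`ConstantinODELemma`).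
`lean search 'energy_le_integral_of_slice|levelSq .* sub'`: nothing of this shape in the tree.

## References

* P. Constantin, Comm. Math. Phys. 104 (1986) 311–326, §1, (1.10)–(1.18) (held text pp. 5–7).
  [Constantin1986]
-/

noncomputable section

open MeasureTheory Set Function Filter
open _root_.Topology
open scoped ENNReal NNReal ContDiff BigOperators

namespace Literature.Analysis.FluidPDE

/-! ## The difference field in coordinates -/

section Coordinates

/-- Components of a difference of vector fields: `(v − V)ᵢ = vᵢ − Vᵢ`. [folklore] -/
theorem pi_sub_apply_comp (v V : EuclideanSpace ℝ (Fin 3) → EuclideanSpace ℝ (Fin 3)) (i : Fin 3) :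
    (fun y => (v - V) y i) = fun y => v y i - V y i := by
  funext y
  simp

/-- `|∇ⁿ(v − V)|² = ∑ᵢ ∑_{|α| = n} (∂^α(vᵢ − Vᵢ))²`. [folklore] -/
theorem levelSq_sub_eq_sum (v V : EuclideanSpace ℝ (Fin 3) → EuclideanSpace ℝ (Fin 3)) (n : ℕ)
    (x : EuclideanSpace ℝ (Fin 3)) :
    levelSq n (v - V) x = ∑ i, ∑ α : Fin n → Fin 3, ipderiv α (fun z => v z i - V z i) x ^ 2 := by
  unfold levelSq dnormSq
  refine Finset.sum_congr rfl fun i _ => Finset.sum_congr rfl fun α _ => ?_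
  rw [pi_sub_apply_comp]

/-- `|∇ⁿ(v − V)|² ≤ 2|∇ⁿv|² + 2|∇ⁿV|²` pointwise (`(a − b)² ≤ 2a² + 2b²` termwise, `∂^α` linear).
[folklore] -/
theorem levelSq_sub_le {v V : EuclideanSpace ℝ (Fin 3) → EuclideanSpace ℝ (Fin 3)}
    (hv : ContDiff ℝ ∞ v) (hV : ContDiff ℝ ∞ V) (n : ℕ) (x : EuclideanSpace ℝ (Fin 3)) :
    levelSq n (v - V) x ≤ 2 * levelSq n v x + 2 * levelSq n V x := by
  rw [levelSq_sub_eq_sum, levelSq, levelSq, Finset.mul_sum, Finset.mul_sum, ← Finset.sum_add_distrib]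
  refine Finset.sum_le_sum fun i _ => ?_
  rw [dnormSq, dnormSq, Finset.mul_sum, Finset.mul_sum, ← Finset.sum_add_distrib]
  refine Finset.sum_le_sum fun α _ => ?_
  have e := ipderiv_sub (contDiff_comp_of_contDiff hv i) (contDiff_comp_of_contDiff hV i) α
  rw [e]
  nlinarith [sq_nonneg (ipderiv α (fun y => v y i) x + ipderiv α (fun y => V y i) x)]

end Coordinates

/-! ## The localised component energies and their time integration -/

section Slab

variable {S ν : ℝ} {u U : ℝ → EuclideanSpace ℝ (Fin 3) → EuclideanSpace ℝ (Fin 3)}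
  {p P : ℝ → EuclideanSpace ℝ (Fin 3) → ℝ}

/-- The fields `(t, x) ↦ ∂^α(uᵢ − Uᵢ)(t, x)` are jointly smooth on `[0, S] × ℝ³`. [folklore] -/
theorem isSmoothSpaceTimeOn_ipderiv_sub (hu : IsClassicalNSSolutionOn (Icc 0 S) ν 0 u p)
    (hU : IsClassicalNSSolutionOn (Icc 0 S) 0 0 U P) (hS : 0 < S) {n : ℕ} (α : Fin n → Fin 3)
    (i : Fin 3) :
    IsSmoothSpaceTimeOn (Icc 0 S) (fun s y => ipderiv α (fun z => u s z i - U s z i) y) :=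
  ((hu.isSmoothSpaceTimeOn_comp i).sub (hU.isSmoothSpaceTimeOn_comp i)).ipderiv_slice
    (uniqueDiffOn_Icc hS) α

/-- Joint continuity of `(t, x) ↦ |∇ⁿ(u − U)(t, x)|²` on `[0, S] × ℝ³`. [folklore] -/
theorem continuousOn_levelSq_sub (hu : IsClassicalNSSolutionOn (Icc 0 S) ν 0 u p)
    (hU : IsClassicalNSSolutionOn (Icc 0 S) 0 0 U P) (hS : 0 < S) (n : ℕ) :
    ContinuousOn (fun z : ℝ × EuclideanSpace ℝ (Fin 3) => levelSq n (u z.1 - U z.1) z.2)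
      (Icc 0 S ×ˢ univ) := by
  have e : (fun z : ℝ × EuclideanSpace ℝ (Fin 3) => levelSq n (u z.1 - U z.1) z.2) =
      fun z => ∑ i, ∑ α : Fin n → Fin 3, ipderiv α (fun y => u z.1 y i - U z.1 y i) z.2 ^ 2 := by
    funext z
    exact levelSq_sub_eq_sum _ _ n z.2
  rw [e]
  exact continuousOn_finsetSum _ fun i _ => continuousOn_finsetSum _ fun α _ =>
    ((isSmoothSpaceTimeOn_ipderiv_sub hu hU hS α i).continuousOn).pow 2

/-- Continuity in time of the localised energies `t ↦ ∫ χ_R |∇ⁿ(u − U)(t)|²`. [folklore] -/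
theorem continuousOn_integral_cutoff_mul_levelSq_sub (hu : IsClassicalNSSolutionOn (Icc 0 S) ν 0 u p)
    (hU : IsClassicalNSSolutionOn (Icc 0 S) 0 0 U P) (hS : 0 < S) {R : ℝ} (hR : 0 < R) (n : ℕ) :
    ContinuousOn (fun t => ∫ x, cutoff R x * levelSq n (u t - U t) x) (Icc 0 S) :=
  continuousOn_integral_mul_of_continuousOn (contDiff_cutoff (n := 0) R).continuous
    (hasCompactSupport_cutoff hR) (continuousOn_levelSq_sub hu hU hS n)

/-- Continuity in time of the localised pairings `t ↦ ∫ χ_R ∂ₜ(∂^α wᵢ) ∂^α wᵢ`, `w = u − U`.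
[folklore] -/
theorem continuousOn_integral_cutoff_mul_timeDerivWithin_ipderiv_sub
    (hu : IsClassicalNSSolutionOn (Icc 0 S) ν 0 u p) (hU : IsClassicalNSSolutionOn (Icc 0 S) 0 0 U P)
    (hS : 0 < S) {R : ℝ} (hR : 0 < R) {n : ℕ} (α : Fin n → Fin 3) (i : Fin 3) :
    ContinuousOn (fun t => ∫ x, cutoff R x *
      (FluidPDE.timeDerivWithin (Icc 0 S) (fun s y => ipderiv α (fun z => u s z i - U s z i) y) t x *
        ipderiv α (fun z => u t z i - U t z i) x)) (Icc 0 S) := by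
  have hW := isSmoothSpaceTimeOn_ipderiv_sub hu hU hS α i
  have hWt := hW.timeDerivWithin (uniqueDiffOn_Icc hS)
  exact continuousOn_integral_mul_of_continuousOn (contDiff_cutoff (n := 0) R).continuous
    (hasCompactSupport_cutoff hR) (hWt.continuousOn.mul hW.continuousOn)

/-- `∑ᵢ ∑_α ∫ χ (∂^α wᵢ)² = ∫ χ |∇ⁿ w|²`, `w = u(t) − U(t)`. [folklore] -/
theorem sum_integral_cutoff_mul_ipderiv_sub_sq (hu : IsClassicalNSSolutionOn (Icc 0 S) ν 0 u p)
    (hU : IsClassicalNSSolutionOn (Icc 0 S) 0 0 U P) {t : ℝ} (ht : t ∈ Icc 0 S) {R : ℝ}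
    (hR : 0 < R) (n : ℕ) :
    ∑ i, ∑ α : Fin n → Fin 3, ∫ x, cutoff R x * ipderiv α (fun z => u t z i - U t z i) x ^ 2 =
      ∫ x, cutoff R x * levelSq n (u t - U t) x := by
  have h1 : Continuous (cutoff (E := EuclideanSpace ℝ (Fin 3)) R) := (contDiff_cutoff (n := 0) R).continuous
  have h2 : HasCompactSupport (cutoff (E := EuclideanSpace ℝ (Fin 3)) R) := hasCompactSupport_cutoff hR
  have cw : ∀ i, ContDiff ℝ ∞ fun z => u t z i - U t z i := fun i =>
    (contDiff_comp_of_contDiff (hu.contDiff_velocity ht) i).sub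
      (contDiff_comp_of_contDiff (hU.contDiff_velocity ht) i)
  have hi : ∀ i (α : Fin n → Fin 3),
      Integrable fun x => cutoff R x * ipderiv α (fun z => u t z i - U t z i) x ^ 2 := fun i α => by
    have h3 : Continuous fun x => ipderiv α (fun z => u t z i - U t z i) x ^ 2 :=
      (continuous_ipderiv (cw i) α).pow 2
    have := integrable_pow_mul_of_continuous h1 h2 h3 one_ne_zero
    simpa only [pow_one] using this
  have hα : ∀ i, ∑ α : Fin n → Fin 3, ∫ x, cutoff R x * ipderiv α (fun z => u t z i - U t z i) x ^ 2 =
      ∫ x, ∑ α : Fin n → Fin 3, cutoff R x * ipderiv α (fun z => u t z i - U t z i) x ^ 2 := fun i =>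
    (integral_finsetSum Finset.univ fun α _ => hi i α).symm
  simp only [hα]
  rw [← integral_finsetSum Finset.univ fun i _ => integrable_finsetSum _ fun α _ => hi i α]
  refine integral_congr_ae (Eventually.of_forall fun x => ?_)
  simp only
  rw [levelSq_sub_eq_sum, Finset.mul_sum]
  refine Finset.sum_congr rfl fun i _ => ?_
  rw [Finset.mul_sum]

/-- **The localised energy identity in time** (Constantin's `d/dt |w|²ₘ`, (1.10), integrated,
with a cut-off): for `t ∈ [0, S]`, `R > 0` and every level `n`,
`∫ χ_R |∇ⁿw(t)|² − ∫ χ_R |∇ⁿw(0)|² = 2 ∫₀ᵗ ∑_{|α| = n} ∑ᵢ ∫ χ_R ∂ₜ(∂^α wᵢ) ∂^α wᵢ`, `w = u − U`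
(fundamental theorem of calculus on time lines and Fubini, component by component).
[cite: Constantin1986, §1 (1.10)] -/
theorem integral_cutoff_levelSq_sub_sub_eq (hu : IsClassicalNSSolutionOn (Icc 0 S) ν 0 u p)
    (hU : IsClassicalNSSolutionOn (Icc 0 S) 0 0 U P) (hS : 0 < S) {R : ℝ} (hR : 0 < R) (n : ℕ)
    {t : ℝ} (ht : t ∈ Icc 0 S) :
    (∫ x, cutoff R x * levelSq n (u t - U t) x) - ∫ x, cutoff R x * levelSq n (u 0 - U 0) x =
      2 * ∫ τ in Ioo 0 t, ∑ i, ∑ α : Fin n → Fin 3, ∫ x, cutoff R x *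
        (FluidPDE.timeDerivWithin (Icc 0 S) (fun s y => ipderiv α (fun z => u s z i - U s z i) y) τ x *
          ipderiv α (fun z => u τ z i - U τ z i) x) := by
  have hφc : Continuous fun x : EuclideanSpace ℝ (Fin 3) => cutoff R x := (contDiff_cutoff (n := 0) R).continuous
  have hφs : HasCompactSupport fun x : EuclideanSpace ℝ (Fin 3) => cutoff R x := hasCompactSupport_cutoff hR
  have h0 : (0 : ℝ) ∈ Icc 0 S := ⟨le_rfl, hS.le⟩
  have hE2 : ∀ i (α : Fin n → Fin 3), ∫ τ in Ioo 0 t, ∫ x, cutoff R x *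
      (FluidPDE.timeDerivWithin (Icc 0 S) (fun s y => ipderiv α (fun z => u s z i - U s z i) y) τ x *
        ipderiv α (fun z => u τ z i - U τ z i) x) =
      2⁻¹ * (∫ x, cutoff R x * ipderiv α (fun z => u t z i - U t z i) x ^ 2) -
        2⁻¹ * (∫ x, cutoff R x * ipderiv α (fun z => u 0 z i - U 0 z i) x ^ 2) := fun i α =>
    (isSmoothSpaceTimeOn_ipderiv_sub hu hU hS α i).integral_Ioo_integral_mul_timeDerivWithin_mul hS
      hφc hφs le_rfl ht.1 ht.2
  have hIo : ∀ i (α : Fin n → Fin 3), IntegrableOn (fun τ => ∫ x, cutoff R x *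
      (FluidPDE.timeDerivWithin (Icc 0 S) (fun s y => ipderiv α (fun z => u s z i - U s z i) y) τ x *
        ipderiv α (fun z => u τ z i - U τ z i) x)) (Ioo 0 t) := fun i α =>
    integrableOn_Ioo_of_continuousOn
      (continuousOn_integral_cutoff_mul_timeDerivWithin_ipderiv_sub hu hU hS hR α i) ht
  rw [integral_finsetSum _ fun i _ => integrable_finsetSum _ fun α _ => hIo i α]
  simp_rw [fun i => integral_finsetSum Finset.univ fun α (_ : α ∈ Finset.univ) => hIo i α]
  simp only [hE2]
  rw [← sum_integral_cutoff_mul_ipderiv_sub_sq hu hU ht hR n,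
    ← sum_integral_cutoff_mul_ipderiv_sub_sq hu hU h0 hR n]
  simp only [Finset.sum_sub_distrib, ← Finset.mul_sum]
  ring

end Slab

/-! ## Boundedness, measurability and closedness of the energy -/

section Props

variable {S ν : ℝ} {u U : ℝ → EuclideanSpace ℝ (Fin 3) → EuclideanSpace ℝ (Fin 3)}
  {p P : ℝ → EuclideanSpace ℝ (Fin 3) → ℝ}

/-- `|∇ⁿ 0|² = 0`. [folklore] -/
theorem levelSq_zero_field (n : ℕ) (x : EuclideanSpace ℝ (Fin 3)) :
    levelSq n (0 : EuclideanSpace ℝ (Fin 3) → EuclideanSpace ℝ (Fin 3)) x = 0 := by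
  unfold levelSq dnormSq
  refine Finset.sum_eq_zero fun i _ => Finset.sum_eq_zero fun α _ => ?_
  have e : (fun y : EuclideanSpace ℝ (Fin 3) => (0 : EuclideanSpace ℝ (Fin 3) → EuclideanSpace ℝ (Fin 3)) y i) =
      fun _ => (0 : ℝ) := by funext y; simp
  rw [e, ipderiv_zero_fun]
  simp

/-- **Integrability and uniform bounds of the level energies of the difference** in the
Beale–Kato–Majda class: for each `n` there is `I` with `|∇ⁿ(u(t) − U(t))|² ∈ L¹` and
`∫|∇ⁿ(u(t) − U(t))|² ≤ I` for all `t ∈ [0, S]`. [folklore] -/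
theorem levelSq_sub_bounds (hu : IsClassicalNSSolutionOn (Icc 0 S) ν 0 u p)
    (hU : IsClassicalNSSolutionOn (Icc 0 S) 0 0 U P) (hbu : HasBoundedSobolevNormsOn (Icc 0 S) u)
    (hbU : HasBoundedSobolevNormsOn (Icc 0 S) U) (n : ℕ) :
    ∃ I : ℝ, 0 ≤ I ∧ ∀ t ∈ Icc 0 S, Integrable (levelSq n (u t - U t)) ∧
      ∫ x, levelSq n (u t - U t) x ≤ I := by
  obtain ⟨⟨Iu, hIu⟩, -⟩ := levelSq_bounds_of_hasBoundedSobolevNormsOn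
    (fun t ht => hu.contDiff_velocity ht) hbu n
  obtain ⟨⟨IU, hIU⟩, -⟩ := levelSq_bounds_of_hasBoundedSobolevNormsOn
    (fun t ht => hU.contDiff_velocity ht) hbU n
  have hS0 : ∀ t ∈ Icc 0 S, 0 ≤ Iu ∧ 0 ≤ IU := fun t ht =>
    ⟨(integral_nonneg fun x => levelSq_nonneg n (u t) x).trans (hIu t ht).2,
      (integral_nonneg fun x => levelSq_nonneg n (U t) x).trans (hIU t ht).2⟩
  refine ⟨2 * |Iu| + 2 * |IU|, by positivity, fun t ht => ?_⟩
  have hv := hu.contDiff_velocity ht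
  have hV := hU.contDiff_velocity ht
  have hdom : Integrable fun x => 2 * levelSq n (u t) x + 2 * levelSq n (U t) x :=
    ((hIu t ht).1.const_mul 2).add ((hIU t ht).1.const_mul 2)
  have hvV : ContDiff ℝ ∞ (u t - U t) := hv.sub hV
  have hint : Integrable (levelSq n (u t - U t)) := by
    refine hdom.mono' (continuous_levelSq hvV n).aestronglyMeasurable
      (Eventually.of_forall fun x => ?_)
    rw [Real.norm_of_nonneg (levelSq_nonneg n _ x)]
    exact levelSq_sub_le hv hV n x
  refine ⟨hint, ?_⟩
  calc ∫ x, levelSq n (u t - U t) x ≤ ∫ x, (2 * levelSq n (u t) x + 2 * levelSq n (U t) x) :=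
        integral_mono hint hdom fun x => levelSq_sub_le hv hV n x
    _ = 2 * (∫ x, levelSq n (u t) x) + 2 * ∫ x, levelSq n (U t) x := by
        rw [integral_add ((hIu t ht).1.const_mul 2) ((hIU t ht).1.const_mul 2), integral_const_mul,
          integral_const_mul]
    _ ≤ 2 * |Iu| + 2 * |IU| := by
        have h1 := (hIu t ht).2.trans (le_abs_self Iu)
        have h2 := (hIU t ht).2.trans (le_abs_self IU)
        linarith

/-- **Measurability in time of the clamped energy**: `s ↦ ∑_{n ≤ k} ∫|∇ⁿ(u − U)(π s)|²` is
measurable, `π` the clamp onto `[0, S]` (parametric integrals of jointly continuous integrands).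
[folklore] -/
theorem measurable_energy_clamp (hu : IsClassicalNSSolutionOn (Icc 0 S) ν 0 u p)
    (hU : IsClassicalNSSolutionOn (Icc 0 S) 0 0 U P) (hS : 0 < S) (k : ℕ) :
    Measurable fun s => ∑ n ∈ Finset.range (k + 1),
      ∫ x, levelSq n (u (max 0 (min s S)) - U (max 0 (min s S))) x := by
  refine Finset.measurable_sum _ fun n _ => ?_
  have hF : Continuous fun q : ℝ × EuclideanSpace ℝ (Fin 3) =>
      levelSq n (u (max 0 (min q.1 S)) - U (max 0 (min q.1 S))) q.2 := by
    have h := (continuousOn_levelSq_sub hu hU hS n).comp_continuous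
      (((continuous_clamp S).comp continuous_fst).prodMk continuous_snd)
      fun q => mk_mem_prod (clamp_mem hS.le q.1) (mem_univ _)
    exact h
  have hFm : StronglyMeasurable fun q : ℝ × EuclideanSpace ℝ (Fin 3) =>
      levelSq n (u (max 0 (min q.1 S)) - U (max 0 (min q.1 S))) q.2 := hF.stronglyMeasurable
  exact (hFm.integral_prod_right' (ν := volume)).measurable

/-- The localised energies are below the energy: `∑ₙ ∫ χ_R |∇ⁿw|² ≤ ∑ₙ ∫ |∇ⁿw|²`. [folklore] -/
theorem sum_integral_cutoff_mul_levelSq_le {v V : EuclideanSpace ℝ (Fin 3) → EuclideanSpace ℝ (Fin 3)}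
    (hv : ContDiff ℝ ∞ v) (hV : ContDiff ℝ ∞ V) {R : ℝ} (hR : 0 < R) (s : Finset ℕ)
    (hI : ∀ n ∈ s, Integrable (levelSq n (v - V))) :
    ∑ n ∈ s, ∫ x, cutoff R x * levelSq n (v - V) x ≤ ∑ n ∈ s, ∫ x, levelSq n (v - V) x := by
  have hvV : ContDiff ℝ ∞ (v - V) := hv.sub hV
  refine Finset.sum_le_sum fun n hn => integral_mono ?_ (hI n hn) fun x => ?_
  · exact (integrable_cutoff_pow_mul (continuous_levelSq hvV n) hR one_ne_zero).congr
      (Eventually.of_forall fun x => by simp only [pow_one])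
  · exact mul_le_of_le_one_left (levelSq_nonneg n _ x) (cutoff_le_one R x)

/-- The localised energies converge to the energy as `R → ∞`. [folklore] -/
theorem tendsto_sum_integral_cutoff_mul_levelSq {v V : EuclideanSpace ℝ (Fin 3) → EuclideanSpace ℝ (Fin 3)}
    (s : Finset ℕ) (hI : ∀ n ∈ s, Integrable (levelSq n (v - V))) :
    Tendsto (fun N : ℕ => ∑ n ∈ s, ∫ x, cutoff ((N : ℝ) + 1) x * levelSq n (v - V) x) atTop
      (𝓝 (∑ n ∈ s, ∫ x, levelSq n (v - V) x)) := by
  refine tendsto_finsetSum _ fun n hn => ?_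
  have h1 := (tendsto_integral_cutoff_pow_mul_atTop (hI n hn) 1).comp
    (tendsto_atTop_add_const_right atTop (1 : ℝ) tendsto_natCast_atTop_atTop)
  refine h1.congr fun N => ?_
  simp only [comp_apply, pow_one]

/-- **Closedness from the left of the energy**: if `∑ₙ∫|∇ⁿw(s)|² ≤ M` for `s ∈ [0, t)`,
`0 < t ≤ S`, then also at `s = t` (each localised energy is continuous in time and below the
energy, and the energy is their limit). [folklore] -/
theorem energy_closed_left (hu : IsClassicalNSSolutionOn (Icc 0 S) ν 0 u p)
    (hU : IsClassicalNSSolutionOn (Icc 0 S) 0 0 U P) (hS : 0 < S)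
    (hbu : HasBoundedSobolevNormsOn (Icc 0 S) u) (hbU : HasBoundedSobolevNormsOn (Icc 0 S) U)
    (k : ℕ) {t : ℝ} (ht : t ∈ Ioc 0 S) {M : ℝ}
    (hM : ∀ s ∈ Ico 0 t, ∑ n ∈ Finset.range (k + 1), ∫ x, levelSq n (u s - U s) x ≤ M) :
    ∑ n ∈ Finset.range (k + 1), ∫ x, levelSq n (u t - U t) x ≤ M := by
  have htI : t ∈ Icc 0 S := ⟨ht.1.le, ht.2⟩
  choose I hI0 hIb using fun n => levelSq_sub_bounds hu hU hbu hbU n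
  have hI : ∀ n, ∀ s ∈ Icc 0 S, Integrable (levelSq n (u s - U s)) := fun n s hs => (hIb n s hs).1
  -- each localised energy at `t` is `≤ M`
  have hloc : ∀ N : ℕ, ∑ n ∈ Finset.range (k + 1),
      ∫ x, cutoff ((N : ℝ) + 1) x * levelSq n (u t - U t) x ≤ M := by
    intro N
    have hR : (0 : ℝ) < N + 1 := by positivity
    set ER : ℝ → ℝ := fun s => ∑ n ∈ Finset.range (k + 1),
      ∫ x, cutoff ((N : ℝ) + 1) x * levelSq n (u s - U s) x with hER
    have hcont : ContinuousOn ER (Icc 0 S) :=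
      continuousOn_finsetSum _ fun n _ => continuousOn_integral_cutoff_mul_levelSq_sub hu hU hS hR n
    have hcwa : ContinuousWithinAt ER (Ico 0 t) t := (hcont t htI).mono (Ico_subset_Icc_self.trans
      (Icc_subset_Icc le_rfl ht.2))
    haveI : (𝓝[Ico 0 t] t).NeBot := by
      refine mem_closure_iff_nhdsWithin_neBot.1 ?_
      rw [closure_Ico ht.1.ne]
      exact right_mem_Icc.2 ht.1.le
    have hev : ∀ᶠ s in 𝓝[Ico 0 t] t, ER s ≤ M := by
      refine eventually_nhdsWithin_of_forall fun s hs => ?_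
      have hsI : s ∈ Icc 0 S := ⟨hs.1, hs.2.le.trans ht.2⟩
      exact (sum_integral_cutoff_mul_levelSq_le (hu.contDiff_velocity hsI) (hU.contDiff_velocity hsI)
        hR _ fun n _ => hI n s hsI).trans (hM s hs)
    exact le_of_tendsto hcwa hev
  exact le_of_tendsto' (tendsto_sum_integral_cutoff_mul_levelSq _ fun n _ => hI n t htI) hloc

end Props

/-! ## The integral inequality and the a priori estimate -/

section Apriori

variable {S ν : ℝ} {u U : ℝ → EuclideanSpace ℝ (Fin 3) → EuclideanSpace ℝ (Fin 3)}
  {p P : ℝ → EuclideanSpace ℝ (Fin 3) → ℝ}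

/-- **The integral energy inequality from the slice inequality** (Constantin 1986, (1.10)
integrated in time). Let `(u, p)` (viscosity `ν`) and `(U, P)` (Euler) be unforced classical
solutions on `[0, S] × ℝ³` in the Beale–Kato–Majda class with `u 0 = U 0`, and suppose that for
every `R ≥ 1` and every interior time the localised pairings satisfy the slice inequality
`2∑_{n ≤ k}∑ᵢ∑_{|α| = n} ∫ χ_R ∂ₜ(∂^α wᵢ) ∂^α wᵢ ≤ Φ(E(t)) + K/R`, `w = u − U`,
`E(t) = ∑_{n ≤ k}∫|∇ⁿw(t)|²`, `Φ(e) = A e + B e √e + ν' K' √e` with `A, B, ν'K' ≥ 0`. Then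
`E(t) ≤ ∫₀ᵗ Φ(E(s)) ds` for all `t ∈ [0, S]`. [cite: Constantin1986, §1 (1.10)-(1.11)] -/
theorem energy_le_integral_of_slice (hu : IsClassicalNSSolutionOn (Icc 0 S) ν 0 u p)
    (hU : IsClassicalNSSolutionOn (Icc 0 S) 0 0 U P) (hS : 0 < S)
    (hbu : HasBoundedSobolevNormsOn (Icc 0 S) u) (hbU : HasBoundedSobolevNormsOn (Icc 0 S) U)
    (h0 : u 0 = U 0) (k : ℕ) {A B K' ν' Kerr : ℝ} (hA : 0 ≤ A) (hB : 0 ≤ B) (hνK : 0 ≤ ν' * K')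
    (hslice : ∀ R : ℝ, 1 ≤ R → ∀ t ∈ Ioo 0 S,
      2 * ∑ n ∈ Finset.range (k + 1), ∑ i, ∑ α : Fin n → Fin 3, ∫ x, cutoff R x *
          (FluidPDE.timeDerivWithin (Icc 0 S) (fun s y => ipderiv α (fun z => u s z i - U s z i) y) t x *
            ipderiv α (fun z => u t z i - U t z i) x) ≤
        (A * (∑ n ∈ Finset.range (k + 1), ∫ x, levelSq n (u t - U t) x) +
          B * ((∑ n ∈ Finset.range (k + 1), ∫ x, levelSq n (u t - U t) x) *
            Real.sqrt (∑ n ∈ Finset.range (k + 1), ∫ x, levelSq n (u t - U t) x)) +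
          ν' * K' * Real.sqrt (∑ n ∈ Finset.range (k + 1), ∫ x, levelSq n (u t - U t) x)) +
        Kerr / R) :
    ∀ t ∈ Icc 0 S, (∑ n ∈ Finset.range (k + 1), ∫ x, levelSq n (u t - U t) x) ≤
      ∫ s in Ioo 0 t, (A * (∑ n ∈ Finset.range (k + 1), ∫ x, levelSq n (u s - U s) x) +
        B * ((∑ n ∈ Finset.range (k + 1), ∫ x, levelSq n (u s - U s) x) *
          Real.sqrt (∑ n ∈ Finset.range (k + 1), ∫ x, levelSq n (u s - U s) x)) +
        ν' * K' * Real.sqrt (∑ n ∈ Finset.range (k + 1), ∫ x, levelSq n (u s - U s) x)) := by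
  set E : ℝ → ℝ := fun t => ∑ n ∈ Finset.range (k + 1), ∫ x, levelSq n (u t - U t) x with hE
  set Φ : ℝ → ℝ := fun e => A * e + B * (e * Real.sqrt e) + ν' * K' * Real.sqrt e with hΦ
  set Ec : ℝ → ℝ := fun s => E (max 0 (min s S)) with hEc
  -- bounds and integrability
  have hbounds := fun n => levelSq_sub_bounds hu hU hbu hbU n
  choose I hI0 hI using hbounds
  set Emax : ℝ := ∑ n ∈ Finset.range (k + 1), I n with hEmax
  have hE0 : ∀ t ∈ Icc 0 S, 0 ≤ E t := fun t ht =>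
    Finset.sum_nonneg fun n _ => integral_nonneg fun x => levelSq_nonneg n _ x
  have hEle : ∀ t ∈ Icc 0 S, E t ≤ Emax := fun t ht => Finset.sum_le_sum fun n _ => (hI n t ht).2
  have hEc_eq : ∀ s ∈ Icc 0 S, Ec s = E s := fun s hs => by simp only [hEc, clamp_eq hs]
  have hEc_meas : Measurable Ec := by
    have := measurable_energy_clamp hu hU hS k
    exact this
  have hΦm : Measurable fun s => Φ (Ec s) := measurable_energy_rhs hEc_meas A B ν' K'
  have hΦ0 : ∀ s ∈ Icc 0 S, 0 ≤ Φ (Ec s) := fun s hs =>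
    energy_rhs_nonneg hA hB hνK (by rw [hEc_eq s hs]; exact hE0 s hs)
  have hΦle : ∀ s ∈ Icc 0 S, Φ (Ec s) ≤ Φ Emax := fun s hs =>
    energy_rhs_mono hA hB hνK (by rw [hEc_eq s hs]; exact hE0 s hs) (by rw [hEc_eq s hs]; exact hEle s hs)
  have hΦint : IntegrableOn (fun s => Φ (Ec s)) (Icc 0 S) :=
    integrableOn_Icc_of_measurable_bound hΦm (C := Φ Emax) fun s hs => by
      rw [abs_of_nonneg (hΦ0 s hs)]; exact hΦle s hs
  intro t ht
  -- the localised bound for `R ≥ 1`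
  have hstep : ∀ R : ℝ, 1 ≤ R → ∑ n ∈ Finset.range (k + 1), ∫ x, cutoff R x * levelSq n (u t - U t) x ≤
      (∫ s in Ioo 0 t, Φ (E s)) + t * (Kerr / R) := by
    intro R hR
    have hR0 : 0 < R := one_pos.trans_le hR
    -- the pairings, level by level
    set Ψ : ℕ → ℝ → ℝ := fun n τ => ∑ i, ∑ α : Fin n → Fin 3, ∫ x, cutoff R x *
      (FluidPDE.timeDerivWithin (Icc 0 S) (fun s y => ipderiv α (fun z => u s z i - U s z i) y) τ x *
        ipderiv α (fun z => u τ z i - U τ z i) x) with hΨ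
    have hΨcont : ∀ n, ContinuousOn (Ψ n) (Icc 0 S) := fun n =>
      continuousOn_finsetSum _ fun i _ => continuousOn_finsetSum _ fun α _ =>
        continuousOn_integral_cutoff_mul_timeDerivWithin_ipderiv_sub hu hU hS hR0 α i
    have hΨint : ∀ n, IntegrableOn (Ψ n) (Ioo 0 t) := fun n => integrableOn_Ioo_of_continuousOn (hΨcont n) ht
    -- the identity `E_R(t) = 2 ∫₀ᵗ ∑ₙ Ψₙ`
    have hzero : ∀ n, ∫ x, cutoff R x * levelSq n (u 0 - U 0) x = 0 := fun n => by
      rw [h0, sub_self]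
      simp only [levelSq_zero_field, mul_zero, integral_zero]
    have hid : ∑ n ∈ Finset.range (k + 1), ∫ x, cutoff R x * levelSq n (u t - U t) x =
        ∫ τ in Ioo 0 t, 2 * ∑ n ∈ Finset.range (k + 1), Ψ n τ := by
      have h1 : ∀ n, ∫ x, cutoff R x * levelSq n (u t - U t) x = 2 * ∫ τ in Ioo 0 t, Ψ n τ := by
        intro n
        have := integral_cutoff_levelSq_sub_sub_eq hu hU hS hR0 n ht
        rw [hzero n, sub_zero] at this
        exact this
      rw [Finset.sum_congr rfl fun n _ => h1 n, ← Finset.mul_sum,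
        ← integral_finsetSum _ fun n _ => hΨint n, ← integral_const_mul]
    rw [hid]
    -- integrate the slice inequality over `(0, t)`
    have hcongr : ∫ s in Ioo 0 t, Φ (E s) = ∫ s in Ioo 0 t, Φ (Ec s) :=
      setIntegral_congr_fun measurableSet_Ioo fun s hs => by
        rw [hEc_eq s ⟨hs.1.le, hs.2.le.trans ht.2⟩]
    have hΦint' : IntegrableOn (fun s => Φ (Ec s)) (Ioo 0 t) :=
      hΦint.mono_set (Ioo_subset_Icc_self.trans (Icc_subset_Icc le_rfl ht.2))
    have hconst : IntegrableOn (fun _ => Kerr / R) (Ioo 0 t) :=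
      integrableOn_const (by rw [Real.volume_Ioo]; exact ENNReal.ofReal_ne_top)
    have hmono : ∫ τ in Ioo 0 t, 2 * ∑ n ∈ Finset.range (k + 1), Ψ n τ ≤
        ∫ τ in Ioo 0 t, (Φ (Ec τ) + Kerr / R) := by
      refine setIntegral_mono_on ((integrable_finsetSum _ fun n _ => hΨint n).const_mul 2)
        (hΦint'.add hconst) measurableSet_Ioo fun τ hτ => ?_
      have hτS : τ ∈ Ioo 0 S := ⟨hτ.1, hτ.2.trans_le ht.2⟩
      have h := hslice R hR τ hτS
      rw [hEc_eq τ ⟨hτ.1.le, hτS.2.le⟩]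
      exact h
    have hsplit : ∫ τ in Ioo 0 t, (Φ (Ec τ) + Kerr / R) = (∫ s in Ioo 0 t, Φ (E s)) + t * (Kerr / R) := by
      rw [integral_add hΦint' hconst, hcongr, setIntegral_const, Real.volume_real_Ioo, sub_zero,
        max_eq_left ht.1, smul_eq_mul]
    exact hmono.trans (le_of_eq hsplit)
  -- `R → ∞`
  have hlim1 : Tendsto (fun N : ℕ => ∑ n ∈ Finset.range (k + 1),
      ∫ x, cutoff ((N : ℝ) + 1) x * levelSq n (u t - U t) x) atTop (𝓝 (E t)) :=
    tendsto_sum_integral_cutoff_mul_levelSq _ fun n _ => (hI n t ht).1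
  have hlim2 : Tendsto (fun N : ℕ => (∫ s in Ioo 0 t, Φ (E s)) + t * (Kerr / ((N : ℝ) + 1))) atTop
      (𝓝 ((∫ s in Ioo 0 t, Φ (E s)) + t * 0)) :=
    tendsto_const_nhds.add (tendsto_const_nhds.mul (tendsto_const_nhds.div_atTop
      (tendsto_atTop_add_const_right atTop (1 : ℝ) tendsto_natCast_atTop_atTop)))
  rw [mul_zero, add_zero] at hlim2
  exact le_of_tendsto_of_tendsto' hlim1 hlim2 fun N => hstep ((N : ℝ) + 1)
    (by have : (0 : ℝ) ≤ N := N.cast_nonneg; linarith)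

/-- **The a priori estimate (Constantin 1986, (1.18), squared).** In the setting of
`energy_le_integral_of_slice`, with `K' > 0`, `ν' > 0`, `S ≤ T`, put `K₀ = K'² T² e^{AT + 1/2}`.
If `ν' B T √K₀ ≤ 1/4`, then `∑_{n ≤ k} ∫|∇ⁿ(u(t) − U(t))|² ≤ K₀ ν'²` for all `t ∈ [0, S]`
(the integral inequality, the properties of the energy — bounded, measurable after clamping,
vanishing at `0`, closed from the left — and the ODE lemma `constantin_energy_bootstrap`; the
constants `A, B, K'`, hence `K₀` and the smallness threshold, are those of the slice inequality,
which in the application depend only on the Euler solution on `[0, T]` and on `k`).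
[cite: Constantin1986, §1 Thm. 1.1 (proof, (1.10)-(1.18))] -/
theorem energy_le_of_slice (hu : IsClassicalNSSolutionOn (Icc 0 S) ν 0 u p)
    (hU : IsClassicalNSSolutionOn (Icc 0 S) 0 0 U P) (hS : 0 < S)
    (hbu : HasBoundedSobolevNormsOn (Icc 0 S) u) (hbU : HasBoundedSobolevNormsOn (Icc 0 S) U)
    (h0 : u 0 = U 0) (k : ℕ) {A B K' ν' Kerr T : ℝ} (hA : 0 ≤ A) (hB : 0 ≤ B) (hK : 0 < K')
    (hν' : 0 < ν') (hST : S ≤ T)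
    (hslice : ∀ R : ℝ, 1 ≤ R → ∀ t ∈ Ioo 0 S,
      2 * ∑ n ∈ Finset.range (k + 1), ∑ i, ∑ α : Fin n → Fin 3, ∫ x, cutoff R x *
          (FluidPDE.timeDerivWithin (Icc 0 S) (fun s y => ipderiv α (fun z => u s z i - U s z i) y) t x *
            ipderiv α (fun z => u t z i - U t z i) x) ≤
        (A * (∑ n ∈ Finset.range (k + 1), ∫ x, levelSq n (u t - U t) x) +
          B * ((∑ n ∈ Finset.range (k + 1), ∫ x, levelSq n (u t - U t) x) *
            Real.sqrt (∑ n ∈ Finset.range (k + 1), ∫ x, levelSq n (u t - U t) x)) +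
          ν' * K' * Real.sqrt (∑ n ∈ Finset.range (k + 1), ∫ x, levelSq n (u t - U t) x)) +
        Kerr / R)
    (hsmall : ν' * (B * T * Real.sqrt (K' ^ 2 * T ^ 2 * Real.exp (A * T + 1 / 2))) ≤ 1 / 4) :
    ∀ t ∈ Icc 0 S, (∑ n ∈ Finset.range (k + 1), ∫ x, levelSq n (u t - U t) x) ≤
      K' ^ 2 * T ^ 2 * Real.exp (A * T + 1 / 2) * ν' ^ 2 := by
  set E : ℝ → ℝ := fun t => ∑ n ∈ Finset.range (k + 1), ∫ x, levelSq n (u t - U t) x with hE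
  set Φ : ℝ → ℝ := fun e => A * e + B * (e * Real.sqrt e) + ν' * K' * Real.sqrt e with hΦ
  set Ec : ℝ → ℝ := fun s => E (max 0 (min s S)) with hEc
  have hbounds := fun n => levelSq_sub_bounds hu hU hbu hbU n
  choose I hI0 hI using hbounds
  set Emax : ℝ := ∑ n ∈ Finset.range (k + 1), I n with hEmax
  have hE0 : ∀ t ∈ Icc 0 S, 0 ≤ E t := fun t ht =>
    Finset.sum_nonneg fun n _ => integral_nonneg fun x => levelSq_nonneg n _ x
  have hEle : ∀ t ∈ Icc 0 S, E t ≤ Emax := fun t ht => Finset.sum_le_sum fun n _ => (hI n t ht).2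
  have hEc_eq : ∀ s ∈ Icc 0 S, Ec s = E s := fun s hs => by simp only [hEc, clamp_eq hs]
  have hEc_meas : Measurable Ec := by
    have := measurable_energy_clamp hu hU hS k
    exact this
  have h0I : (0 : ℝ) ∈ Icc 0 S := ⟨le_rfl, hS.le⟩
  have hE00 : E 0 = 0 := by
    simp only [hE]
    refine Finset.sum_eq_zero fun n _ => ?_
    rw [h0, sub_self]
    simp only [levelSq_zero_field, integral_zero]
  have hint := energy_le_integral_of_slice hu hU hS hbu hbU h0 k hA hB (mul_nonneg hν'.le hK.le) hslice
  have hboot := constantin_energy_bootstrap (E := Ec) (Emax := Emax) hS hST hA hB hK hν' hEc_meas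
    (fun t ht => by rw [hEc_eq t ht]; exact hE0 t ht)
    (fun t ht => by rw [hEc_eq t ht]; exact hEle t ht)
    (by rw [hEc_eq 0 h0I]; exact hE00)
    (fun t ht M hM => by
      rw [hEc_eq t ⟨ht.1.le, ht.2⟩]
      exact energy_closed_left hu hU hS hbu hbU k ht fun s hs => by
        have h := hM s hs
        rw [hEc_eq s ⟨hs.1, hs.2.le.trans ht.2⟩] at h
        exact h)
    (fun t ht => by
      rw [hEc_eq t ht]
      refine (hint t ht).trans (le_of_eq ?_)
      exact setIntegral_congr_fun measurableSet_Ioo fun s hs => by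
        rw [hEc_eq s ⟨hs.1.le, hs.2.le.trans ht.2⟩])
    hsmall
  intro t ht
  have h := hboot t ht
  rwa [hEc_eq t ht] at h

end Apriori

end Literature.Analysis.FluidPDE

end
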